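/-
Origin: expansion seat `prover-pub-hodgecm-own-htheta-0`, handover #H12 2026-08-21T05:31Z md5 e6356ff01975 (48 l.; NEW additive E-SHAPED child «JBUARM» = «JBUAR» at own-mu's `μ := ArchSideTerm.muSharp₂₃ @ArchSideTerm.muSlotZero` — ON-WORD CARGO: HOLD OUT unless an S6-mandated seat words it ≤ cutoff₇₃ (like #H5 ∕ «UAR» ∕ «UARM»); imports #H11 + own-mu #MU1 `HodgeCM.Model.ArchMuClosedForm` (RUN 72); ROWDEPS #H11, PKG #MU1; 1 theorem: perL_picardCM_r20AEOGISTR2DJWHHTCGJBUARM (hHD hI h₁ h₃) (hGRU) (h418) : U.PerL — 2 groups: CITE 1 [GR91 3.1.1] + CITED-AS-CONSEQUENCE 1 [Liu21 Thm 4.18 r8]; CONSTRUCT 0 ∕ DATA 0 ∕ HYP 0; NAMES for audit: HodgeCM.Model.perL_picardCM_r20AEOGISTR2DJWHHTCGJBUARM) (`HOME/pub-hodgecm-own-htheta/stage73/HodgeCM/Model/E2InstanceOGR20AEPISTR2DJWHHTCGJBUARM.lean`, md5 e6356ff01975, 48 lines);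
landed by the second packager p2 gen 20 (p2-g20) in gate run 74 as `HodgeCM/Model/E2InstanceOGR20AEPISTR2DJWHHTCGJBUARM.lean` (verbatim).
-/
/-
Copyright (c) 2026 the pub-hodgecm formalisation cell (harness21).  New file, not vendored.
Origin: ROW-9 OWNER seat `prover-pub-hodgecm-own-htheta-0` (unit pub-hodgecm-own-htheta), 2026-08-21 — SIBLING CARGO (lead (α-UJ)(ii)), child of
this seat's «…JBUAR» (`Model/E2InstanceOGR20AEPISTR2DJWHHTCGJB`) at own-mu's row-6 closed form (their «ARM»∕«UARM» pattern, JOINT LINE (a)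
co-signed STATUS 2026-08-21T04:41:59Z).  Target in PKG: `HodgeCM/Model/E2InstanceOGR20AEPISTR2DJWHHTCGJBUARM.lean` (NEW additive leaf; imports
the «JB» leaf + own-mu #MU1 `Model/ArchMuClosedForm` (RUN 72); nothing imports it).  KERNEL ONLY: 1 theorem.  Nothing here is a claim of the
manuscripts under adjudication.
-/
import Summits.HodgeConjecture.HodgeCM.Model.E2InstanceOGR20AEPISTR2DJWHHTCGJB
import Summits.HodgeConjecture.HodgeCM.Model.ArchMuClosedForm

/-! PORT of `HodgeCM/Model/E2InstanceOGR20AEPISTR2DJWHHTCGJBUARM.lean` (HodgeCMPerL run 82) — verbatim mechanical port; provenance in the PORT header line. -/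

set_option autoImplicit false

noncomputable section

namespace HodgeCM

namespace Model

open Literature.AlgebraicGeometry.HodgeTheory
open Literature.NumberTheory.Automorphic.PicardCM
open Literature.NumberTheory.GelbartRogawski1991.UnitaryDualPair

variable (hHD : exists_isReal_hodgeModel) (hI : hodgePQ_independent_of_hodgeModel)
  (h₁ : BallQuotientUniformised) (h₃ : CMAbelianVarietyEigenbasisRealised)

/-- **«…JBUARM»: PerL OF THE MODEL UNIVERSE MODULO [GR91, Prop. 3.1.1] AND ONE READING OF [Liu21, Thm. 4.18]** — «…JBUAR» at own-mu's
row-6 closed form `μ := ArchSideTerm.muSharp₂₃ @ArchSideTerm.muSlotZero` (their #MU1; row 9 places no constraint on `μ`): binder groups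
**`hGRU` (CITE [GR91, Prop. 3.1.1], verbatim) and `h418` (the combined reading r8 `Thm418C` of [Liu21 Thm 4.18 + (4.3) + (1) + Rem 4.17 +
Prop 4.13 + Lem 2.4 (1)], CITED-AS-CONSEQUENCE per CF07, at the embedding of record)** — CONSTRUCT 0 ∕ DATA 0 ∕ displayed model HYP 0.
[folklore] -/
theorem perL_picardCM_r20AEOGISTR2DJWHHTCGJBUARM
    (hGRU : ∀ (L : Type) [Field L] [NumberField L] [NumberField.IsCMField L] {N M n : ℕ} (e : Fin N × Fin M ≃ Fin n)
      (dV : Fin N → L) (hdV : ∀ i, NumberField.IsCMField.complexConj L (dV i) = dV i) (hdV0 : ∀ i, dV i ≠ 0)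
      (dW : Fin M → L) (hdW : ∀ i, NumberField.IsCMField.complexConj L (dW i) = dW i) (hdW0 : ∀ i, dW i ≠ 0),
      (cmSplittingDatum L e dV hdV hdV0 dW hdW hdW0).CompatibleSplitting)
    (h418 : ∀ {L : CMField} {ι₁ : L →+* ℂ} (V : HermSpace3 L ι₁), (NumberField.InfinitePlace.mk ι₁).embedding = ι₁ → ∀ a₀ : LiuIndex.RealScalar L,
      (liuDictionaryPin hHD hI h₁ (cmAbelianVarietyRealised_of_eigenbasis hHD hI h₃) Literature.NumberTheory.Transcendental.arapura2012_cor_15_4_6_holds V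
          (LiuIndex.I V (LiuIndex.repAt a₀) (LiuIndex.muLiu ι₁ LiuIndex.GramClass.rep))
          (LiuIndex.line V (LiuIndex.repAt a₀) (LiuIndex.muLiu ι₁ LiuIndex.GramClass.rep))).Thm418C) :
     (picardCMUniverse hHD hI h₁ (cmAbelianVarietyRealised_of_eigenbasis hHD hI h₃)).PerL :=
  perL_picardCM_r20AEOGISTR2DJWHHTCGJBUAR hHD hI h₁ h₃ hGRU (ArchSideTerm.muSharp₂₃ @ArchSideTerm.muSlotZero) h418

end Model

end HodgeCM

end
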